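import Summits.QuantumFields.YangMills.Theorems.BalabanUVNodesPortS1LZHalfRegL
import Summits.QuantumFields.YangMills.Theorems.BalabanUVNodesPortS1FEInductionByName
import Summits.QuantumFields.YangMills.Theorems.BalabanUVNodesPortS1FEStepConverse
import Summits.QuantumFields.YangMills.Theorems.BalabanUVNodesPortS1FEStepReg
import Summits.QuantumFields.YangMills.Theorems.BalabanUVNodesPortRecordRepresentationS1StubG3C

/-!
# NODE O port PT-A — THE CLOSING FRAME OF ⟨27930⟩ AFTER gen 11 (line `pta_residueW`, skeleton v3.7): the crux `PortRecordRepresentationS1` BY NAME from FOUR displayed letters —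
# `stub_P0C`'s `P0HolExtAtRecordGL`, the two class letters `ClassP2Reg` ∕ `ClassP5NestReg` (★★★ №633's shape), and `stub_FEstepReg`'s `FEStepReg` (`stub_G3C` ✓, `stub_LZhalfReg` a theorem
# modulo the first three by ✓`lzHalfReg_of_P0C_of_classP2_of_classP5Nest`); and the first-cut five-letter frame (`ClassP5Reg` ∕ `ClassNestsUc` instead of `ClassP5NestReg`)

Cell `ym-nodeO-ideate`, porter seat PT-A-1 (gen 11); `--kind proof --supports stmt-QuantumFields-27930 --as helper`; count-neutral.  [I] = [Balaban1987RG1].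

WHY.  v3.7's composition is `PortRecordRepresentationS1_of stub_P0C stub_G3C stub_LZhalfReg stub_FEstepReg` (tree `Cruxes/PortRecordRepresentationS1/Lines/pta_residueW.lean`, byte-frozen).  With
✓`stub_G3C` (p824985) and gen 11's bricks ✓`lzHalfReg_of_P0C_of_classP2_of_classP5Nest` ∕ ✓`lzHalfReg_of_P0C_of_classP2` the crux is a THEOREM MODULO EXACTLY the letters named in the
title; this file records both compositions in the kernel (the v3.5∕v3.6 landed composition ✓`PortRecordRepresentationS1_of_step` fed from the ε₀-class pair by ✓`portRecordFEHalfBox_of_reg` → ✓`feStepBox_of_feHalfBox`, exactly as the skeleton does).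
* ★★★ `portRecordRepresentationS1_of_lettersL` (four letters, №633's shape) · `portRecordRepresentationS1_of_letters` (five letters, first cut).

HONEST FRAMING.  CONDITIONAL bookkeeping: the letters are inhabited NOWHERE (`P0HolExtAtRecordGL` = node00-def-Y's M2-ℂ scheme; `ClassP2Reg`∕`ClassP5NestReg` (∕ `ClassP5Reg`∕`ClassNestsUc`) =
its class by-products ∕ [15] Thm 1 regularity; `FEStepReg` = [I] §2–§5 + [II], XXL); no registry act; nothing of Bałaban's RG estimates asserted, ported or discharged; ⟨27930⟩ OPEN 1∕4 · no claim; NODE O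
0∕1; COUNT 8∕28 · K 1∕4 UNMOVED; finite `𝕋⁴_{L^K}` at fixed ε — NOT continuum ∕ OS; **the Yang–Mills mass gap (Clay) is NOT proved by any of this.**  No `sorry`, no `def`; standard axioms.
-/

noncomputable section

namespace Summit.QuantumFields.YangMills.Theorems.BalabanUVNodesPortS1

open Summit.QuantumFields.YangMills.Theorems.K0RecordFormatNames
open Literature.MathematicalPhysics.QuantumFieldTheory.Balaban1983to89.T4Continuum (T4Family)

/-- ★★★ **⟨27930⟩ BY NAME FROM THE FOUR LETTERS** `P0HolExtAtRecordGL`, `ClassP2Reg`, `ClassP5NestReg`, `FEStepReg` (each for every torus family; ★★★ №633's letter shape): the route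
declaration `Summit.QuantumFields.YangMills.Theses.BalabanUVNodes.PortRecordRepresentationS1` — v3.7's composition with `stub_G3C` ✓ landed and `stub_LZhalfReg` supplied by
✓`lzHalfReg_of_P0C_of_classP2_of_classP5Nest`.  CONDITIONAL; asserted for nothing beyond its hypotheses. [cite: Balaban1987RG1, Theorem 3 p.264, (1.6)–(1.21) pp.261–264, (2.11)–(2.14) pp.267–268, p.263 L5–13] -/
theorem portRecordRepresentationS1_of_lettersL (hP0C : ∀ F, P0HolExtAtRecordGL F) (hC2 : ∀ F, ClassP2Reg F) (hC5 : ∀ F, ClassP5NestReg F) (hFE : ∀ F, FEStepReg F) :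
    Summit.QuantumFields.YangMills.Theses.BalabanUVNodes.PortRecordRepresentationS1 :=
  PortRecordRepresentationS1_of_step hP0C stub_G3C
    (fun F => feStepBox_of_feHalfBox (portRecordFEHalfBox_of_reg (lzHalfReg_of_P0C_of_classP2_of_classP5Nest hP0C hC2 hC5) hFE F))

/-- ★★★ **⟨27930⟩ BY NAME FROM THE FIVE LETTERS** `P0HolExtAtRecordGL`, `ClassP2Reg`, `ClassP5Reg`, `ClassNestsUc`, `FEStepReg` (each for every torus family): the route declaration
`Summit.QuantumFields.YangMills.Theses.BalabanUVNodes.PortRecordRepresentationS1` — v3.7's composition with `stub_G3C` ✓ landed and `stub_LZhalfReg` supplied by ✓`lzHalfReg_of_P0C_of_classP2`.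
CONDITIONAL; asserted for nothing beyond its hypotheses. [cite: Balaban1987RG1, Theorem 3 p.264, (1.6)–(1.21) pp.261–264, (2.11)–(2.14) pp.267–268, p.263 L5–13] -/
theorem portRecordRepresentationS1_of_letters (hP0C : ∀ F, P0HolExtAtRecordGL F) (hC2 : ∀ F, ClassP2Reg F) (hC5 : ∀ F, ClassP5Reg F) (hN : ∀ F, ClassNestsUc F)
    (hFE : ∀ F, FEStepReg F) :
    Summit.QuantumFields.YangMills.Theses.BalabanUVNodes.PortRecordRepresentationS1 :=
  PortRecordRepresentationS1_of_step hP0C stub_G3C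
    (fun F => feStepBox_of_feHalfBox (portRecordFEHalfBox_of_reg (lzHalfReg_of_P0C_of_classP2 hP0C hC2 hC5 hN) hFE F))

end Summit.QuantumFields.YangMills.Theorems.BalabanUVNodesPortS1

end
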